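import Summits.Ventures.PercRepro.SevenThreeSmallPlanesFrame

/-!
# PercRepro — the `(7,3)` cell, (R6) part (g0): the two chain-independent glue lemmas (night-3, gen 4)

For the glue `perPlane_positive_of_core` (`SevenThreeSmallPlanes.lean`): the type `t = 7 − ρ(E ∖ G) ∈ {1, 2, 3}` of
a plane with `ρ(E ∖ G) < 7` in a rank-`7` matroid (`exists_type_of_lt`), and `|L ∩ G| ≤ 3` for every line `L` when
no `4`-subset of `G` has rank `≤ 2` (`card_inter_le_three_of_no_long` — the chain's `not_hasLongLine_of_core`
supplies the hypothesis).  Axioms: standard.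
-/

namespace PercRepro

namespace SevenThree

open Finset ThmH SixThree PerFlat

variable {α : Type*} [DecidableEq α] {M : Matroid α} [M.Finite]

/-- A plane `G` of a rank-`7` matroid with `ρ(E ∖ G) < 7` has type `t ∈ {1, 2, 3}`: `ρ(E ∖ G) + t = 7`. -/
theorem exists_type_of_lt {G : Finset α} (hG : G ∈ planes M) (hrank : M.eRank = 7)
    (hlt : M.eRk ((gr M \ G : Finset α) : Set α) < 7) :
    ∃ t : ℕ, 1 ≤ t ∧ t ≤ 3 ∧ M.eRk ((gr M \ G : Finset α) : Set α) + (t : ℕ∞) = 7 := by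
  have hGg : G ⊆ gr M := (mem_planes.1 hG).1
  have hG3 := (mem_planes.1 hG).2.2
  have h7 : M.eRk ((gr M : Finset α) : Set α) = 7 := by rw [coe_gr, M.eRk_ground, hrank]
  have hle : (7 : ℕ∞) ≤ 3 + M.eRk ((gr M \ G : Finset α) : Set α) := by
    calc (7 : ℕ∞) = M.eRk ((gr M : Finset α) : Set α) := h7.symm
      _ = M.eRk ((G ∪ (gr M \ G) : Finset α) : Set α) := by rw [Finset.union_sdiff_of_subset hGg]
      _ ≤ M.eRk (G : Set α) + M.eRk ((gr M \ G : Finset α) : Set α) := by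
          rw [Finset.coe_union]; exact M.eRk_union_le_eRk_add_eRk _ _
      _ = 3 + M.eRk ((gr M \ G : Finset α) : Set α) := by rw [hG3]
  obtain ⟨e, he, -⟩ := eRk_eq_nat M (gr M \ G)
  rw [he] at hle hlt ⊢
  have hle' : 7 ≤ 3 + e := by exact_mod_cast hle
  have hlt' : e < 7 := by exact_mod_cast hlt
  refine ⟨7 - e, by omega, by omega, ?_⟩
  exact_mod_cast (show e + (7 - e) = 7 by omega)

/-- If no `4`-subset of `G` has rank `≤ 2`, every line meets `G` in at most `3` points. -/
theorem card_inter_le_three_of_no_long {G : Finset α}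
    (h4 : ∀ Q ∈ G.powersetCard 4, ¬ M.eRk (Q : Set α) ≤ 2) {L : Finset α} (hL : L ∈ lines M) :
    (L ∩ G).card ≤ 3 := by
  by_contra h
  push Not at h
  obtain ⟨Q, hQ, hQ4⟩ := Finset.exists_subset_card_eq (show 4 ≤ (L ∩ G).card by omega)
  apply h4 Q (Finset.mem_powersetCard.2 ⟨hQ.trans Finset.inter_subset_right, hQ4⟩)
  calc M.eRk (Q : Set α) ≤ M.eRk (L : Set α) :=
        M.eRk_mono (Finset.coe_subset.2 (hQ.trans Finset.inter_subset_left))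
    _ = 2 := (mem_lines.1 hL).2.2

end SevenThree

end PercRepro
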